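import Literature.MathematicalPhysics.QuantumLattice.GrassmannIntegrationByParts
import Literature.MathematicalPhysics.QuantumLattice.GrassmannTruncatedSpectators
import Mathlib.Data.Sym.Sym2
import HarnessLib

/-!
# Field-supported subalgebras, parity of the Grassmann derivative, and the pair Laplacians of a
# cluster decomposition

Topic `Literature/MathematicalPhysics/QuantumLattice`; first file of the single-scale step of the
fermionic renormalisation group in the *Laplacian* host (`GrassmannLaplacian.lean`: `Δ_C`,
`μ_C ⋆ = e^{Δ_C}`; `GrassmannEffectiveAction.lean`: `effAction`), after Salmhofer 1999, §4.3 and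
Benfatto–Giuliani–Mastropietro 2006, §2.3.  For the Brydges–Battle–Federbush interpolation of
`e^{Δ_C}` between *clusters* (vertices) one writes the field labels `Γ` as a disjoint union of
clusters, `cl : Γ → ι`, and splits the Laplacian by the *type* `{cl X, cl Y} ∈ Sym2 ι` of the pair of
labels it contracts:

* `fieldSubalgebra R S` — the subalgebra generated by the fields `ψ(X)`, `X ∈ S` (no linear order on
  `Γ` is needed, unlike `spectatorSubalgebra`); `grassmannDeriv_eq_zero_of_mem_fieldSubalgebra`
  (`∂_X` kills it for `X ∉ S`), `grassmannDeriv_mem_fieldSubalgebra`,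
  `involute_mem_fieldSubalgebra`;
* `grassmannDeriv_mem_evenOdd` — `∂_X` shifts the parity; `grassmannDeriv_mul_of_mem_evenOdd_zero`
  (plain Leibniz rule for an even left factor) and `grassmannDeriv_mul_eq_mul_of_mem`
  (`∂_X (a b) = a ∂_X b` for an even `a` supported away from `X`);
* `typeRestrict C cl ℓ` (the covariance restricted to the pairs of type `ℓ`) and the **pair
  Laplacian** `pairLaplacian R C cl ℓ = Δ_{C|ℓ}`: `sum_pairLaplacian` (`Σ_ℓ Δ_{C|ℓ} = Δ_C`), more
  generally `grassmannLaplacian_scaleByType` (`Δ_{p ∘ C} = Σ_ℓ p_ℓ Δ_{C|ℓ}` for pair variables `p`),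
  commutation and nilpotency (inherited from `GrassmannLaplacian.lean`);
* the support calculus used at the decoupled interpolation point: `grassmannLaplacian_mul_eq_mul_of_mem`
  (`Δ_{C'} (a b) = a Δ_{C'} b` when `C'` vanishes on the labels of the even, supported `a`),
  `grassmannLaplacian_eq_zero_of_mem` (`Δ_{C'} a = 0` when every pair charged by `C'` has a label outside
  the support of `a`), and their instances for the pair Laplacians (`pairLaplacian_mul_eq_mul_left`,
  `pairLaplacian_eq_zero_of_not_subset`); `grassmannLaplacian_mem_evenOdd`,
  `gaussConv_mem_evenOdd` (parity is preserved).

Everything is proved; no named fact.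

## Sources

M. Salmhofer, *Renormalization: An Introduction* (Springer 1999), §4.3.1–4.3.2, (4.86)–(4.91)
(bib key `Salmhofer1999`); G. Benfatto, A. Giuliani, V. Mastropietro, Ann. Henri Poincaré 7 (2006)
809–898, §2.3 (2.66) (bib key `BenfattoGiulianiMastropietro2006`); F. A. Berezin, *The Method of
Second Quantization* (1966), Ch. I §3 (bib key `Berezin1966`).
-/

noncomputable section

namespace Literature.MathematicalPhysics.QuantumLattice

open GrassmannAlgebra Finset

/-! ### Subalgebras generated by a set of fields -/

section Support

variable (R : Type*) [CommRing R] {Γ : Type*} [DecidableEq Γ]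

/-- The **subalgebra of the fields `ψ(X)`, `X ∈ S`**: the polynomials in the generators with
labels in `S` (the algebra of one cluster / of one block of fields). [folklore] -/
def fieldSubalgebra (S : Set Γ) : Subalgebra R (GrassmannAlgebra R Γ) :=
  Algebra.adjoin R (gen R '' S)

/-- Generators with labels in `S` belong to `fieldSubalgebra S`. [folklore] -/
theorem gen_mem_fieldSubalgebra {S : Set Γ} {X : Γ} (hX : X ∈ S) : gen R X ∈ fieldSubalgebra R S :=
  Algebra.subset_adjoin ⟨X, hX, rfl⟩

/-- Monotonicity in the label set. [folklore] -/
theorem fieldSubalgebra_mono {S T : Set Γ} (h : S ⊆ T) : fieldSubalgebra R S ≤ fieldSubalgebra R T :=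
  Algebra.adjoin_mono (Set.image_mono h)

omit [DecidableEq Γ] in
/-- The parity automorphism negates generators… stated for `ι v`. [folklore] -/
theorem involute_ι_eq (v : Γ → R) :
    CliffordAlgebra.involute (ExteriorAlgebra.ι R v : GrassmannAlgebra R Γ) = -ExteriorAlgebra.ι R v :=
  CliffordAlgebra.involute_ι _

/-- The parity automorphism negates generators. [folklore] -/
theorem involute_gen (X : Γ) : CliffordAlgebra.involute (gen R X) = -gen R X :=
  involute_ι_eq R _

/-- `fieldSubalgebra S` is stable under the parity automorphism. [folklore] -/
theorem involute_mem_fieldSubalgebra {S : Set Γ} {a : GrassmannAlgebra R Γ} (ha : a ∈ fieldSubalgebra R S) :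
    CliffordAlgebra.involute a ∈ fieldSubalgebra R S := by
  induction ha using Algebra.adjoin_induction with
  | mem x hx =>
    obtain ⟨X, hX, rfl⟩ := hx
    rw [involute_gen]
    exact neg_mem (gen_mem_fieldSubalgebra R hX)
  | algebraMap r => rw [AlgHom.commutes]; exact Subalgebra.algebraMap_mem _ r
  | add x y _ _ hx hy => rw [map_add]; exact add_mem hx hy
  | mul x y _ _ hx hy => rw [map_mul]; exact mul_mem hx hy

/-- **A derivative in a label outside `S` kills `fieldSubalgebra S`**: `∂_X a = 0` for `X ∉ S`.
[folklore] -/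
theorem grassmannDeriv_eq_zero_of_mem_fieldSubalgebra {S : Set Γ} {X : Γ} (hX : X ∉ S)
    {a : GrassmannAlgebra R Γ} (ha : a ∈ fieldSubalgebra R S) : grassmannDeriv R X a = 0 := by
  induction ha using Algebra.adjoin_induction with
  | mem x hx =>
    obtain ⟨Y, hY, rfl⟩ := hx
    rw [grassmannDeriv_gen, if_neg]
    rintro rfl
    exact hX hY
  | algebraMap r => exact grassmannDeriv_algebraMap R X r
  | add x y _ _ hx hy => rw [map_add, hx, hy, add_zero]
  | mul x y _ _ hx hy => rw [grassmannDeriv_mul, hx, hy, zero_mul, mul_zero, add_zero]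

/-- Derivatives preserve `fieldSubalgebra S`. [folklore] -/
theorem grassmannDeriv_mem_fieldSubalgebra {S : Set Γ} (X : Γ) {a : GrassmannAlgebra R Γ}
    (ha : a ∈ fieldSubalgebra R S) : grassmannDeriv R X a ∈ fieldSubalgebra R S := by
  induction ha using Algebra.adjoin_induction with
  | mem x hx =>
    obtain ⟨Y, hY, rfl⟩ := hx
    rw [grassmannDeriv_gen]
    split_ifs
    · exact one_mem _
    · exact zero_mem _
  | algebraMap r => rw [grassmannDeriv_algebraMap]; exact zero_mem _
  | add x y _ _ hx hy => rw [map_add]; exact add_mem hx hy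
  | mul x y hx hy ihx ihy =>
    rw [grassmannDeriv_mul]
    exact add_mem (mul_mem ihx hy) (mul_mem (involute_mem_fieldSubalgebra R hx) ihy)

end Support

/-! ### Parity of the derivative and the Leibniz rule for even factors -/

section Parity

variable (R : Type*) [CommRing R] {Γ : Type*}

/-- **Leibniz rule for an even left factor**: `∂_X (a b) = (∂_X a) b + a (∂_X b)` for `a` even.
[folklore] -/
theorem grassmannDeriv_mul_of_mem_evenOdd_zero (X : Γ) {a : GrassmannAlgebra R Γ} (ha : a ∈ evenOdd R 0)
    (b : GrassmannAlgebra R Γ) :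
    grassmannDeriv R X (a * b) = grassmannDeriv R X a * b + a * grassmannDeriv R X b :=
  grassmannDeriv_mul_of_involute_eq R X (CliffordAlgebra.involute_eq_of_mem_even ha) b

/-- The derivative of a product of two degree-one elements is of degree one. [folklore] -/
theorem grassmannDeriv_ι_mul_ι_mem (X : Γ) (v w : Γ → R) :
    grassmannDeriv R X (ExteriorAlgebra.ι R v * ExteriorAlgebra.ι R w) ∈ evenOdd R (1 : ZMod 2) := by
  rw [grassmannDeriv_ι_mul, grassmannDeriv_ι, ← Algebra.commutes, ← Algebra.smul_def]
  exact sub_mem (Submodule.smul_mem _ _ (CliffordAlgebra.ι_mem_evenOdd_one _ _))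
    (Submodule.smul_mem _ _ (CliffordAlgebra.ι_mem_evenOdd_one _ _))

/-- **The derivative shifts the parity**: `∂_X` maps `evenOdd i` to `evenOdd (i + 1)`. [folklore] -/
theorem grassmannDeriv_mem_evenOdd (X : Γ) {i : ZMod 2} {a : GrassmannAlgebra R Γ} (ha : a ∈ evenOdd R i) :
    grassmannDeriv R X a ∈ evenOdd R (i + 1) := by
  induction a, ha using CliffordAlgebra.evenOdd_induction with
  | range_ι_pow v h =>
    -- `v ∈ (range ι)^(i.val)` with `i.val ≤ 1`
    have key : ∀ (k : ℕ) (u : GrassmannAlgebra R Γ),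
        u ∈ LinearMap.range (CliffordAlgebra.ι (0 : QuadraticForm R (Γ → R))) ^ k → k ≤ 1 →
          grassmannDeriv R X u ∈ evenOdd R ((k : ZMod 2) + 1) := by
      intro k u hu hk
      interval_cases k
      · rw [pow_zero, Submodule.mem_one] at hu
        obtain ⟨r, rfl⟩ := hu
        rw [grassmannDeriv_algebraMap]
        exact zero_mem _
      · rw [pow_one, LinearMap.mem_range] at hu
        obtain ⟨w, rfl⟩ := hu
        have hw : grassmannDeriv R X (CliffordAlgebra.ι (0 : QuadraticForm R (Γ → R)) w) =
            algebraMap R _ (w X) := grassmannDeriv_ι R X w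
        rw [hw, show ((1 : ℕ) : ZMod 2) + 1 = 0 by decide]
        exact SetLike.algebraMap_mem_graded _ _
    have h' := key i.val v h (by have := i.val_lt; omega)
    rwa [ZMod.natCast_zmod_val] at h'
  | add x y hx hy ihx ihy => rw [map_add]; exact add_mem ihx ihy
  | ι_mul_ι_mul m₁ m₂ x hx ih =>
    rw [grassmannDeriv_mul_of_mem_evenOdd_zero R X (CliffordAlgebra.ι_mul_ι_mem_evenOdd_zero _ m₁ m₂)]
    refine add_mem ?_ ?_
    · have h := SetLike.mul_mem_graded (grassmannDeriv_ι_mul_ι_mem R X m₁ m₂) hx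
      rwa [add_comm] at h
    · have h := SetLike.mul_mem_graded (CliffordAlgebra.ι_mul_ι_mem_evenOdd_zero _ m₁ m₂) ih
      rwa [zero_add] at h

variable [DecidableEq Γ]

/-- `∂_X (a b) = a ∂_X b` for an even `a` supported on labels `S ∌ X`. [folklore] -/
theorem grassmannDeriv_mul_eq_mul_of_mem {S : Set Γ} {X : Γ} (hX : X ∉ S) {a : GrassmannAlgebra R Γ}
    (ha : a ∈ fieldSubalgebra R S) (ha0 : a ∈ evenOdd R 0) (b : GrassmannAlgebra R Γ) :
    grassmannDeriv R X (a * b) = a * grassmannDeriv R X b := by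
  rw [grassmannDeriv_mul_of_mem_evenOdd_zero R X ha0, grassmannDeriv_eq_zero_of_mem_fieldSubalgebra R hX ha,
    zero_mul, zero_add]

/-- `∂_X (a b) = (∂_X a) b` for `b` (of any parity) supported on labels `S ∌ X`. [folklore] -/
theorem grassmannDeriv_mul_eq_mul_of_mem_right {S : Set Γ} {X : Γ} (hX : X ∉ S) (a : GrassmannAlgebra R Γ)
    {b : GrassmannAlgebra R Γ} (hb : b ∈ fieldSubalgebra R S) :
    grassmannDeriv R X (a * b) = grassmannDeriv R X a * b := by
  rw [grassmannDeriv_mul, grassmannDeriv_eq_zero_of_mem_fieldSubalgebra R hX hb, mul_zero, add_zero]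

end Parity

/-! ### Laplacians of covariances vanishing on a support -/

section LaplacianSupport

variable (R : Type*) [CommRing R] [Algebra ℚ R] {Γ : Type*} [Fintype Γ] [DecidableEq Γ]

/-- **`Δ_{C'} (a b) = a Δ_{C'} b`** when the even element `a` is supported on labels `S` and the
covariance `C'` charges no label of `S` (`C' X Y = 0` as soon as `X ∈ S` or `Y ∈ S`). [folklore] -/
theorem grassmannLaplacian_mul_eq_mul_of_mem (C' : Matrix Γ Γ R) {S : Set Γ}
    (hC : ∀ X Y, X ∈ S ∨ Y ∈ S → C' X Y = 0) {a : GrassmannAlgebra R Γ}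
    (ha : a ∈ fieldSubalgebra R S) (ha0 : a ∈ evenOdd R 0) (b : GrassmannAlgebra R Γ) :
    grassmannLaplacian R C' (a * b) = a * grassmannLaplacian R C' b := by
  rw [grassmannLaplacian_apply, grassmannLaplacian_apply, mul_smul_comm, Finset.mul_sum]
  congr 1
  refine Finset.sum_congr rfl fun X _ => ?_
  rw [Finset.mul_sum]
  refine Finset.sum_congr rfl fun Y _ => ?_
  by_cases hXY : X ∈ S ∨ Y ∈ S
  · rw [hC X Y hXY, zero_smul, zero_smul, mul_zero]
  · push Not at hXY
    rw [grassmannDeriv_mul_eq_mul_of_mem R hXY.2 ha ha0, grassmannDeriv_mul_eq_mul_of_mem R hXY.1 ha ha0,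
      mul_smul_comm]

/-- **`Δ_{C'} (a b) = (Δ_{C'} a) b`** when `b` is supported on labels `S` and `C'` charges no label of
`S`. [folklore] -/
theorem grassmannLaplacian_mul_eq_mul_of_mem_right (C' : Matrix Γ Γ R) {S : Set Γ}
    (hC : ∀ X Y, X ∈ S ∨ Y ∈ S → C' X Y = 0) (a : GrassmannAlgebra R Γ) {b : GrassmannAlgebra R Γ}
    (hb : b ∈ fieldSubalgebra R S) :
    grassmannLaplacian R C' (a * b) = grassmannLaplacian R C' a * b := by
  rw [grassmannLaplacian_apply, grassmannLaplacian_apply, smul_mul_assoc, Finset.sum_mul]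
  congr 1
  refine Finset.sum_congr rfl fun X _ => ?_
  rw [Finset.sum_mul]
  refine Finset.sum_congr rfl fun Y _ => ?_
  by_cases hXY : X ∈ S ∨ Y ∈ S
  · rw [hC X Y hXY, zero_smul, zero_smul, zero_mul]
  · push Not at hXY
    rw [grassmannDeriv_mul_eq_mul_of_mem_right R hXY.2 a hb,
      grassmannDeriv_mul_eq_mul_of_mem_right R hXY.1 _ hb, smul_mul_assoc]

/-- **`Δ_{C'} a = 0`** when `a` is supported on `S` and every pair charged by `C'` has a label outside
`S` (`C' X Y ≠ 0 → X ∉ S ∨ Y ∉ S`). [folklore] -/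
theorem grassmannLaplacian_eq_zero_of_mem (C' : Matrix Γ Γ R) {S : Set Γ}
    (hC : ∀ X Y, X ∈ S → Y ∈ S → C' X Y = 0) {a : GrassmannAlgebra R Γ} (ha : a ∈ fieldSubalgebra R S) :
    grassmannLaplacian R C' a = 0 := by
  rw [grassmannLaplacian_apply]
  refine smul_eq_zero_of_right _ (Finset.sum_eq_zero fun X _ => Finset.sum_eq_zero fun Y _ => ?_)
  by_cases hY : Y ∈ S
  · by_cases hX : X ∈ S
    · rw [hC X Y hX hY, zero_smul]
    · rw [grassmannDeriv_eq_zero_of_mem_fieldSubalgebra R hX (grassmannDeriv_mem_fieldSubalgebra R Y ha),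
        smul_zero]
  · rw [grassmannDeriv_eq_zero_of_mem_fieldSubalgebra R hY ha, map_zero, smul_zero]

omit [DecidableEq Γ] in
/-- The Laplacian preserves parity. [folklore] -/
theorem grassmannLaplacian_mem_evenOdd (C : Matrix Γ Γ R) {i : ZMod 2} {a : GrassmannAlgebra R Γ}
    (ha : a ∈ evenOdd R i) : grassmannLaplacian R C a ∈ evenOdd R i := by
  rw [grassmannLaplacian_apply]
  refine Submodule.smul_mem _ _ (Submodule.sum_mem _ fun X _ => Submodule.sum_mem _ fun Y _ =>
    Submodule.smul_mem _ _ ?_)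
  have h := grassmannDeriv_mem_evenOdd R X (grassmannDeriv_mem_evenOdd R Y ha)
  rwa [add_assoc, show (1 : ZMod 2) + 1 = 0 from rfl, add_zero] at h

omit [DecidableEq Γ] in
/-- Powers of the Laplacian preserve parity. [folklore] -/
theorem grassmannLaplacian_pow_mem_evenOdd (C : Matrix Γ Γ R) (n : ℕ) {i : ZMod 2} {a : GrassmannAlgebra R Γ}
    (ha : a ∈ evenOdd R i) : (grassmannLaplacian R C ^ n) a ∈ evenOdd R i := by
  induction n with
  | zero => simpa using ha
  | succ n ih => rw [pow_succ', Module.End.mul_apply]; exact grassmannLaplacian_mem_evenOdd R C ih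

omit [DecidableEq Γ] in
/-- **The Gaussian convolution preserves parity**: `μ_C ⋆` maps `evenOdd i` to itself. [folklore] -/
theorem gaussConv_mem_evenOdd (C : Matrix Γ Γ R) {i : ZMod 2} {a : GrassmannAlgebra R Γ}
    (ha : a ∈ evenOdd R i) : gaussConv R C a ∈ evenOdd R i := by
  obtain ⟨k, hk⟩ := isNilpotent_grassmannLaplacian R C
  rw [gaussConv_def, IsNilpotent.exp_eq_sum hk]
  simp only [LinearMap.coe_sum, Finset.sum_apply, LinearMap.smul_apply]
  exact Submodule.sum_mem _ fun n _ => Submodule.smul_of_tower_mem _ _ (grassmannLaplacian_pow_mem_evenOdd R C n ha)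

/-- The Laplacian preserves `fieldSubalgebra S`. [folklore] -/
theorem grassmannLaplacian_mem_fieldSubalgebra (C : Matrix Γ Γ R) {S : Set Γ} {a : GrassmannAlgebra R Γ}
    (ha : a ∈ fieldSubalgebra R S) : grassmannLaplacian R C a ∈ fieldSubalgebra R S := by
  rw [grassmannLaplacian_apply]
  refine Subalgebra.smul_mem _ (Subalgebra.sum_mem _ fun X _ => Subalgebra.sum_mem _ fun Y _ =>
    Subalgebra.smul_mem _ ?_ _) _
  exact grassmannDeriv_mem_fieldSubalgebra R X (grassmannDeriv_mem_fieldSubalgebra R Y ha)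

/-- Powers of the Laplacian preserve `fieldSubalgebra S`. [folklore] -/
theorem grassmannLaplacian_pow_mem_fieldSubalgebra (C : Matrix Γ Γ R) (n : ℕ) {S : Set Γ}
    {a : GrassmannAlgebra R Γ} (ha : a ∈ fieldSubalgebra R S) :
    (grassmannLaplacian R C ^ n) a ∈ fieldSubalgebra R S := by
  induction n with
  | zero => simpa using ha
  | succ n ih => rw [pow_succ', Module.End.mul_apply]; exact grassmannLaplacian_mem_fieldSubalgebra R C ih

/-- The Gaussian convolution preserves `fieldSubalgebra S`. [folklore] -/
theorem gaussConv_mem_fieldSubalgebra (C : Matrix Γ Γ R) {S : Set Γ} {a : GrassmannAlgebra R Γ}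
    (ha : a ∈ fieldSubalgebra R S) : gaussConv R C a ∈ fieldSubalgebra R S := by
  obtain ⟨k, hk⟩ := isNilpotent_grassmannLaplacian R C
  rw [gaussConv_def, IsNilpotent.exp_eq_sum hk]
  simp only [LinearMap.coe_sum, Finset.sum_apply, LinearMap.smul_apply]
  refine Subalgebra.sum_mem _ fun n _ => ?_
  rw [← algebraMap_smul R]
  exact Subalgebra.smul_mem _ (grassmannLaplacian_pow_mem_fieldSubalgebra R C n ha) _

end LaplacianSupport

/-! ### The pair Laplacians of a cluster decomposition -/

section PairLaplacian

variable (R : Type*) [CommRing R] [Algebra ℚ R] {Γ : Type*} [Fintype Γ] [DecidableEq Γ]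
variable {ι : Type*} [DecidableEq ι] (C : Matrix Γ Γ R) (cl : Γ → ι)

variable {R} in
/-- The covariance **restricted to the pairs of type `ℓ`**: `C|ℓ (X, Y) = [{cl X, cl Y} = ℓ] C(X, Y)`
(`ℓ ∈ Sym2 ι` an unordered pair of clusters, the diagonal pairs `{v, v}` included). [folklore] -/
def typeRestrict (ℓ : Sym2 ι) : Matrix Γ Γ R :=
  Matrix.of fun X Y => if s(cl X, cl Y) = ℓ then C X Y else 0

omit [Algebra ℚ R] [Fintype Γ] [DecidableEq Γ] in
/-- Unfolding `typeRestrict`. [folklore] -/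
@[simp] theorem typeRestrict_apply (ℓ : Sym2 ι) (X Y : Γ) :
    typeRestrict C cl ℓ X Y = if s(cl X, cl Y) = ℓ then C X Y else 0 := rfl

variable {R} in
/-- The covariance **scaled by pair variables**: `(p ∘ C)(X, Y) = p_{{cl X, cl Y}} C(X, Y)` (the
interpolated covariance of the Brydges–Battle–Federbush formula; Benfatto–Giuliani–Mastropietro
2006, (2.67): `G^{h,T}_{ij,i'j'} = t_{i,i'} g(x_{ij} - y_{i'j'})`). [folklore] -/
def scaleByType (p : Sym2 ι → R) : Matrix Γ Γ R :=
  Matrix.of fun X Y => p s(cl X, cl Y) * C X Y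

omit [Algebra ℚ R] [Fintype Γ] [DecidableEq Γ] [DecidableEq ι] in
/-- Unfolding `scaleByType`. [folklore] -/
@[simp] theorem scaleByType_apply (p : Sym2 ι → R) (X Y : Γ) :
    scaleByType C cl p X Y = p s(cl X, cl Y) * C X Y := rfl

omit [Algebra ℚ R] [Fintype Γ] [DecidableEq Γ] in
/-- The scaled covariance is the `p`-weighted sum of the type restrictions. [folklore] -/
theorem scaleByType_eq_sum [Fintype ι] (p : Sym2 ι → R) :
    scaleByType C cl p = ∑ ℓ : Sym2 ι, p ℓ • typeRestrict C cl ℓ := by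
  ext X Y
  simp only [scaleByType_apply, Matrix.sum_apply, Matrix.smul_apply, typeRestrict_apply, smul_eq_mul, mul_ite,
    mul_zero, Finset.sum_ite_eq, Finset.mem_univ, if_true]

omit [Algebra ℚ R] [Fintype Γ] [DecidableEq Γ] [DecidableEq ι] in
/-- All pair variables equal to one: the covariance itself. [folklore] -/
theorem scaleByType_one : scaleByType C cl (fun _ => 1) = C := by
  ext X Y; simp

/-- The **pair Laplacian** of type `ℓ`: `Δ_{C|ℓ} = ½ Σ_{{cl X, cl Y} = ℓ} C(X,Y) ∂_X ∂_Y`, the part of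
`Δ_C` contracting a field of cluster `v` with a field of cluster `v'`, `ℓ = {v, v'}`. [folklore] -/
def pairLaplacian (ℓ : Sym2 ι) : Module.End R (GrassmannAlgebra R Γ) :=
  grassmannLaplacian R (typeRestrict C cl ℓ)

omit [DecidableEq Γ] in
/-- **`Δ_{p ∘ C} = Σ_ℓ p_ℓ Δ_{C|ℓ}`**: the Laplacian of the interpolated covariance is the weighted sum
of the pair Laplacians. [folklore] -/
theorem grassmannLaplacian_scaleByType [Fintype ι] (p : Sym2 ι → R) :
    grassmannLaplacian R (scaleByType C cl p) = ∑ ℓ : Sym2 ι, p ℓ • pairLaplacian R C cl ℓ := by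
  rw [scaleByType_eq_sum]
  induction (Finset.univ : Finset (Sym2 ι)) using Finset.induction_on with
  | empty => simp
  | insert ℓ s hℓ ih =>
    rw [Finset.sum_insert hℓ, Finset.sum_insert hℓ, grassmannLaplacian_add, grassmannLaplacian_smul, ih,
      pairLaplacian]

omit [DecidableEq Γ] in
/-- **`Σ_ℓ Δ_{C|ℓ} = Δ_C`.** [folklore] -/
theorem sum_pairLaplacian [Fintype ι] : ∑ ℓ : Sym2 ι, pairLaplacian R C cl ℓ = grassmannLaplacian R C := by
  have h := grassmannLaplacian_scaleByType R C cl (fun _ => (1 : R))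
  simp only [one_smul] at h
  rw [← h, scaleByType_one]

omit [DecidableEq Γ] in
/-- Pair Laplacians commute. [folklore] -/
theorem commute_pairLaplacian (ℓ ℓ' : Sym2 ι) : Commute (pairLaplacian R C cl ℓ) (pairLaplacian R C cl ℓ') :=
  commute_grassmannLaplacian R _ _

omit [DecidableEq Γ] in
/-- Pair Laplacians are nilpotent. [folklore] -/
theorem isNilpotent_pairLaplacian (ℓ : Sym2 ι) : IsNilpotent (pairLaplacian R C cl ℓ) :=
  isNilpotent_grassmannLaplacian R _

/-- **A pair Laplacian one of whose clusters lies outside `Q` kills the algebra of the fields of `Q`**: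
`Δ_{C|ℓ} a = 0` for `a ∈ fieldSubalgebra (cl⁻¹ Q)` and `ℓ ⊄ Q`. [folklore] -/
theorem pairLaplacian_eq_zero_of_not_subset {Q : Set ι} {ℓ : Sym2 ι} (hℓ : ∃ w ∈ ℓ, w ∉ Q)
    {a : GrassmannAlgebra R Γ} (ha : a ∈ fieldSubalgebra R (cl ⁻¹' Q)) : pairLaplacian R C cl ℓ a = 0 := by
  refine grassmannLaplacian_eq_zero_of_mem R _ (fun X Y hX hY => ?_) ha
  rw [typeRestrict_apply, if_neg]
  rintro rfl
  obtain ⟨w, hw, hwQ⟩ := hℓ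
  rcases Sym2.mem_iff.1 hw with rfl | rfl
  · exact hwQ hX
  · exact hwQ hY

/-- **A pair Laplacian inside `Qᶜ` passes an even factor supported on `Q`**:
`Δ_{C|ℓ} (a b) = a Δ_{C|ℓ} b` for `a` even in `fieldSubalgebra (cl⁻¹ Q)` and both clusters of `ℓ`
outside `Q`. [folklore] -/
theorem pairLaplacian_mul_eq_mul_left {Q : Set ι} {ℓ : Sym2 ι} (hℓ : ∀ w ∈ ℓ, w ∉ Q)
    {a : GrassmannAlgebra R Γ} (ha : a ∈ fieldSubalgebra R (cl ⁻¹' Q)) (ha0 : a ∈ evenOdd R 0)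
    (b : GrassmannAlgebra R Γ) : pairLaplacian R C cl ℓ (a * b) = a * pairLaplacian R C cl ℓ b := by
  refine grassmannLaplacian_mul_eq_mul_of_mem R _ (fun X Y hXY => ?_) ha ha0 b
  rw [typeRestrict_apply, if_neg]
  rintro rfl
  rcases hXY with hX | hY
  · exact hℓ (cl X) (Sym2.mem_mk_left _ _) hX
  · exact hℓ (cl Y) (Sym2.mem_mk_right _ _) hY

/-- **A pair Laplacian outside `Q'` passes a right factor supported on `Q'`**:
`Δ_{C|ℓ} (a b) = (Δ_{C|ℓ} a) b` for `b` in `fieldSubalgebra (cl⁻¹ Q')` and both clusters of `ℓ`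
outside `Q'`. [folklore] -/
theorem pairLaplacian_mul_eq_mul_right {Q' : Set ι} {ℓ : Sym2 ι} (hℓ : ∀ w ∈ ℓ, w ∉ Q')
    (a : GrassmannAlgebra R Γ) {b : GrassmannAlgebra R Γ} (hb : b ∈ fieldSubalgebra R (cl ⁻¹' Q')) :
    pairLaplacian R C cl ℓ (a * b) = pairLaplacian R C cl ℓ a * b := by
  refine grassmannLaplacian_mul_eq_mul_of_mem_right R _ (fun X Y hXY => ?_) a hb
  rw [typeRestrict_apply, if_neg]
  rintro rfl
  rcases hXY with hX | hY
  · exact hℓ (cl X) (Sym2.mem_mk_left _ _) hX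
  · exact hℓ (cl Y) (Sym2.mem_mk_right _ _) hY

omit [Algebra ℚ R] [Fintype Γ] [DecidableEq ι] in
/-- The product over `Q` of cluster-supported even elements is supported on the fields of `Q`.
[folklore] -/
theorem coe_prod_mem_fieldSubalgebra_preimage {M : ι → evenPart R Γ}
    (hM : ∀ v, (M v : GrassmannAlgebra R Γ) ∈ fieldSubalgebra R (cl ⁻¹' {v})) (Q : Finset ι) :
    ((∏ v ∈ Q, M v : evenPart R Γ) : GrassmannAlgebra R Γ) ∈ fieldSubalgebra R (cl ⁻¹' (Q : Set ι)) :=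
  coe_prod_mem _ M Q fun v hv =>
    fieldSubalgebra_mono R (Set.preimage_mono (Set.singleton_subset_iff.2 (Finset.mem_coe.2 hv))) (hM v)

end PairLaplacian

end Literature.MathematicalPhysics.QuantumLattice
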